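import Literature.Computability.AlgebraicComplexity.Bur24UnboundedDegreeClasses
import Literature.Computability.AlgebraicComplexity.CircuitGateSemantics
import Mathlib.Data.List.GetD
import HarnessLib

/-!
# Malod's generic computation `(G_n)` is `VPnb⁰`-complete (Bürgisser 2024 survey, §4.2, (4.3))

P. Bürgisser, *Completeness classes in algebraic complexity theory* (arXiv:2406.06217, 2024), §4.2,
proof outline of Thm. 4.6 (held text `paper:arxiv-2406.06217`, p0016 L42–L54):

> For fixed `n` we consider the generic computation `G_{-n} = 1, G_{-n+1} = x_1, …, G_0 = x_n,
> G_1, …, G_n` defined recursively by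
> (4.3) `G_m := (Σ_{i=-n}^{m-1} a_{mi} G_i) · (Σ_{j=-n}^{m-1} b_{mj} G_j)`, for `1 ≤ m ≤ n`.
> Here, the `x_1, …, x_n` are considered the input variables and the `a_{mi}, b_{mj}` are
> auxiliary new variables (see [Bürgisser 2000]). Note that `G_m` can be computed by a
> constant-free circuit of size `O(mn + m²)`. By specializing the auxiliary variables, it is easy
> to see that `(G_n)` is a `VPnb⁰`-complete sequence.

PART 1 defines the generic computation and PROVES the membership half "`G_m` can be computed
by a constant-free circuit of size `O(mn + m²)`" / `(G_n) ∈ VPnb⁰` (`IsVPnb0Family`,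
`Bur24UnboundedDegreeClasses.lean`); PART 2 PROVES the hardness half "by specializing the
auxiliary variables": every fan-in-two circuit `P` over `σ`, with coefficients in ANY commutative
ring `k`, is a specialisation of `G_N`, `N = #σ + 2|P| + 1`, by variables and constants of `k` —
sign constants when `P` is constant-free (`MalodGeneric.eval_eq_aeval_spec_genericComputation`,
`MalodGeneric.spec_isVarOrConst`, `MalodGeneric.spec_isVarOrSignConst`), whence **`Bur24_sec4_2_genericComputation_VPnb0Complete`**
("(G_n) is a `VPnb⁰`-complete sequence": membership, and every `VPnb⁰` family is a p-projection of
`(G_n)` with substituted constants in `{0, ±1}`) and `IsVPnb0Family.isPProjection_genericComputation`.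

## Rendering

Coefficients: an arbitrary commutative ring `k` (explicit first argument of every definition;
`k = ℤ` for the constant-free classes — the survey's setting —, a field `F` for the classes
`VPnb^F` "allowing constants in `F` for free", p0016 L8–L11). Value indices `q = 0, …, 2n`: `q = 0` is `G_{-n} = 1`, `1 ≤ q ≤ n` is `G_{-n+q} = x_q`, and
`q = n + m` (`1 ≤ m ≤ n`) is `G_m`. Variables `MalodGeneric.Var n = Fin (n+1) ⊕ (Fin (n+1) ×
Fin (2n+1) × Bool)`: `inl q` is `x_q` (`q = 1, …, n`; `inl 0` unused), `inr (m, q, false)` is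
`a_{m,q}` and `inr (m, q, true)` is `b_{m,q}` (level `m`, value index `q`; indices are written
through `Fin.ofNat : ℕ → Fin (k+1)`, out-of-range ones are never used). `MalodGeneric.value n q`
is the `q`-th value, defined by the recursion (4.3) along the list of earlier values
(`MalodGeneric.valList`), and `genericComputation k n = value k n (2n) = G_n`.

* `MalodGeneric.value_input`, `MalodGeneric.value_level` — the defining equations
  `G_{-n} = 1`, `G_{-n+q} = x_q`, and **(4.3)**;
* `MalodGeneric.circuit n` — ONE fan-in-two constant-free circuit of size `n (8n + 1)` computing
  `G_n` (level `m+1` is a block of `8n + 1` gates: for each side `a`/`b`, `2n` products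
  `a_{m+1,q} · G_q` interleaved with `2n` running sums, then one product; value indices not yet
  available in a level read the constant `0`), `MalodGeneric.circuit_computes`,
  `MalodGeneric.circuit_isFanInTwo`, `MalodGeneric.circuit_hasSignConstants`,
  `MalodGeneric.circuit_size`;
* **`isVPnb0Family_genericComputation`** — `(G_n) ∈ VPnb⁰`;
* PART 2: `MalodGeneric.enc`, `MalodGeneric.aCoef`, `MalodGeneric.bCoef`, `MalodGeneric.spec` (the
  specialisation), `MalodGeneric.expect`, `MalodGeneric.aeval_spec_value` (the simulation, by
  strong induction on the value index, on the tree's per-gate semantics `ArithCircuit.gateVal` /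
  `ArithCircuit.opVal` of `CircuitGateSemantics.lean`), `MalodGeneric.spec_isVarOrSignConst`,
  `MalodGeneric.eval_eq_aeval_spec_genericComputation`,
  **`Bur24_sec4_2_genericComputation_VPnb0Complete`**, `IsVPnb0Family.isPProjection_genericComputation`.

## References

* [Burgisser2024Completeness] P. Bürgisser, arXiv:2406.06217 (2024), §4.2, (4.3) (p0016 L42–L54).
* G. Malod, *The complexity of polynomials and their coefficient functions*, CCC 2007
  ([malod:07] of the survey); P. Bürgisser, *Completeness and Reduction in Algebraic Complexity
  Theory*, Springer 2000 ([buer:00-3]), for the generic computation.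
-/

noncomputable section

open MvPolynomial

namespace Literature.Computability.AlgebraicComplexity

universe u v

/-! ## A block tool for straight-line programs (re-derived from the tree's
`KV20UniversalCircuit.lean` for general coefficients, to keep imports light) -/

namespace ArithCircuit

variable {k : Type u} [CommSemiring k] {τ : Type v}

/-- Reading a prescribed earlier value. [folklore] -/
private theorem getD_map_range' {f : ℕ → MvPolynomial τ k} {m j : ℕ} (hj : j < m) :
    ((List.range m).map f).getD j 0 = f j := by
  rw [List.getD_eq_getElem?_getD, List.getElem?_map, List.getElem?_range hj]
  rfl

/-- **Values of an appended `List.range`-indexed block with prescribed values**: if gate `g r`,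
evaluated against the values of the prefix `pre` followed by ANY list of length `r` agreeing with
`f` below `r`, has the value `f r`, then the values of `pre ++ [g 0, …, g (m-1)]` are those of `pre`
followed by `f 0, …, f (m-1)` (Bürgisser 2000, Def. 2.1: instruction `r` uses only earlier
results). [cite: Burgisser2000, Def. 2.1] -/
theorem gateValues_append_map_range' (pre : List (Gate k τ)) (m : ℕ) (g : ℕ → Gate k τ)
    (f : ℕ → MvPolynomial τ k)
    (h : ∀ r < m, ∀ ws : List (MvPolynomial τ k), ws.length = r →
      (∀ j < r, ws.getD j 0 = f j) → (g r).eval (gateValues pre ++ ws) = f r) :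
    gateValues (pre ++ (List.range m).map g) = gateValues pre ++ (List.range m).map f := by
  induction m with
  | zero => simp
  | succ m ih =>
    have ih' := ih fun r hr => h r (by omega)
    rw [List.range_succ, List.map_append, List.map_singleton, ← List.append_assoc,
      gateValues_append_singleton, ih', h m (by omega) ((List.range m).map f) (by simp)
        (fun j hj => getD_map_range' hj), List.map_append, List.map_singleton, List.append_assoc]

end ArithCircuit

namespace MalodGeneric

open ArithCircuit

/-- The variables of the generic computation `G_n`: `inl q` = the input `x_q` (`1 ≤ q ≤ n`),
`inr (m, q, false)` = `a_{m,q}`, `inr (m, q, true)` = `b_{m,q}` (level `1 ≤ m ≤ n`, value index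
`0 ≤ q < n + m`). [cite: Burgisser2024Completeness, §4.2 (4.3) (p0016 L42–L50)] -/
abbrev Var (n : ℕ) : Type := Fin (n + 1) ⊕ (Fin (n + 1) × Fin (2 * n + 1) × Bool)

variable (k : Type u) [CommRing k] (n : ℕ)

/-- The index of the coefficient variable `a_{m,q}` (`s = false`) / `b_{m,q}` (`s = true`).
[cite: Burgisser2024Completeness, §4.2 (4.3) (p0016 L48–L50)] -/
def coefIdx (m q : ℕ) (s : Bool) : Var n :=
  Sum.inr (Fin.ofNat (n + 1) m, Fin.ofNat (2 * n + 1) q, s)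

/-- The coefficient variable `a_{m,q}` / `b_{m,q}` as a polynomial. [cite: Burgisser2024Completeness, §4.2 (4.3) (p0016 L48–L50)] -/
def coef (m q : ℕ) (s : Bool) : MvPolynomial (Var n) k := X (coefIdx n m q s)

/-- The inputs: value index `0` is `G_{-n} = 1`, value index `1 ≤ q ≤ n` is `x_q`.
[cite: Burgisser2024Completeness, §4.2 (p0016 L44–L45)] -/
def input (q : ℕ) : MvPolynomial (Var n) k :=
  if q = 0 then 1 else X (Sum.inl (Fin.ofNat (n + 1) q))

/-- The linear form `Σ_{q < |vs|} a_{m,q} · vs[q]` (side `false`) / `Σ b_{m,q} · vs[q]` (side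
`true`) of level `m` against the list `vs` of earlier values. [cite: Burgisser2024Completeness, §4.2 (4.3) (p0016 L48–L50)] -/
def linForm (m : ℕ) (s : Bool) (vs : List (MvPolynomial (Var n) k)) : MvPolynomial (Var n) k :=
  ((List.range vs.length).map fun q => coef k n m q s * vs.getD q 0).sum

/-- The next value given the list of earlier values: an input while fewer than `n + 1` values
exist, then (4.3). [cite: Burgisser2024Completeness, §4.2 (4.3) (p0016 L44–L50)] -/
def next (vs : List (MvPolynomial (Var n) k)) : MvPolynomial (Var n) k :=
  if vs.length ≤ n then input k n vs.length
  else linForm k n (vs.length - n) false vs * linForm k n (vs.length - n) true vs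

/-- The list of the first `q` values `G_{-n}, …`. [cite: Burgisser2024Completeness, §4.2 (4.3) (p0016 L44–L50)] -/
def valList : ℕ → List (MvPolynomial (Var n) k)
  | 0 => []
  | q + 1 => valList q ++ [next k n (valList q)]

/-- **The `q`-th value of the generic computation** (`q = 0`: `G_{-n} = 1`; `1 ≤ q ≤ n`: `x_q`;
`q = n + m`: `G_m`). [cite: Burgisser2024Completeness, §4.2 (4.3) (p0016 L44–L50)] -/
def value (q : ℕ) : MvPolynomial (Var n) k := next k n (valList k n q)

/-- **Malod's generic computation `G_n`** (the top level, value index `2n`).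
[cite: Burgisser2024Completeness, §4.2 (4.3) (p0016 L44–L54)] -/
def genericComputation : MvPolynomial (Var n) k := value k n (2 * n)

/-! ### The defining equations -/

/-- There are `q` values below index `q`. [cite: Burgisser2024Completeness, §4.2 (4.3) (p0016 L44–L50)] -/
theorem length_valList (q : ℕ) : (valList k n q).length = q := by
  induction q with
  | zero => rfl
  | succ q ih => simp [valList, ih]

/-- The value list is the list of values. [cite: Burgisser2024Completeness, §4.2 (4.3) (p0016 L44–L50)] -/
theorem valList_eq (q : ℕ) : valList k n q = (List.range q).map (value k n) := by
  induction q with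
  | zero => rfl
  | succ q ih => rw [valList, ih, List.range_succ, List.map_append, List.map_singleton, value, ih]

/-- `G_{-n} = 1` and `G_{-n+q} = x_q` (`1 ≤ q ≤ n`). [cite: Burgisser2024Completeness, §4.2 (p0016 L44–L45)] -/
theorem value_input {q : ℕ} (hq : q ≤ n) : value k n q = input k n q := by
  rw [value, next, length_valList, if_pos hq]

/-- `G_{-n} = 1`. [cite: Burgisser2024Completeness, §4.2 (p0016 L44)] -/
theorem value_zero : value k n 0 = 1 := by
  rw [value_input k n (Nat.zero_le n), input, if_pos rfl]

/-- **(4.3)**: `G_m = (Σ_{i<m} a_{mi} G_i)(Σ_{j<m} b_{mj} G_j)`, the sums over ALL earlier values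
(inputs included), at value index `q = n + m > n`. [cite: Burgisser2024Completeness, §4.2 (4.3) (p0016 L48–L50)] -/
theorem value_level {q : ℕ} (hq : n < q) :
    value k n q = ((List.range q).map fun q' => coef k n (q - n) q' false * value k n q').sum *
      ((List.range q).map fun q' => coef k n (q - n) q' true * value k n q').sum := by
  rw [value, next, length_valList, if_neg (not_le.2 hq), linForm, linForm, length_valList,
    valList_eq]
  have h : ∀ s, ((List.range q).map fun q' => coef k n (q - n) q' s *
      ((List.range q).map (value k n)).getD q' 0) =
      (List.range q).map fun q' => coef k n (q - n) q' s * value k n q' := by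
    intro s
    refine List.map_congr_left fun q' hq' => ?_
    rw [List.getD_eq_getElem?_getD, List.getElem?_map, List.getElem?_range (List.mem_range.1 hq')]
    rfl
  rw [h, h]

/-! ## The circuit: one block of `8n + 1` gates per level -/

/-- The operand reading value index `q` inside the block of level `m + 1` (values `q ≤ n + m` are
available: the constant `1`, an input variable, or the final gate of an earlier block; later
indices read the constant `0`). [cite: Burgisser2024Completeness, §4.2 (p0016 L50–L51)] -/
def opd (m q : ℕ) : Operand k (Var n) :=
  if q = 0 then .const 1
  else if q ≤ n then .var (Sum.inl (Fin.ofNat (n + 1) q))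
  else if q ≤ n + m then .gate ((q - n - 1) * (8 * n + 1) + 8 * n)
  else .const 0

/-- The value read by `opd k n m q`: `G_q` if available, else `0`. [cite: Burgisser2024Completeness, §4.2 (p0016 L50–L51)] -/
def tval (m q : ℕ) : MvPolynomial (Var n) k := if q ≤ n + m then value k n q else 0

/-- Gate `r < 4n` of one side (`a` or `b`) of the block of level `m + 1`, the side starting at the
absolute gate index `B`: even `r = 2q` is the product `coef · G_q`, odd `r = 2q + 1` the running
sum `L_q = t_q + L_{q-1}` (`L_0 = t_0`). [cite: Burgisser2024Completeness, §4.2 (p0016 L50–L51)] -/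
def sideGate (m : ℕ) (s : Bool) (B r : ℕ) : Gate k (Var n) :=
  if r % 2 = 0 then .prod [.var (coefIdx n (m + 1) (r / 2) s), opd k n m (r / 2)]
  else if r = 1 then .sum [(1, .gate B)]
  else .sum [(1, .gate (B + r - 1)), (1, .gate (B + r - 2))]

/-- Gate `r ≤ 8n` of the block of level `m + 1` (base `B = m (8n+1)`): side `a` (`r < 4n`), side
`b` (`4n ≤ r < 8n`), and the product of the two complete running sums (`r = 8n`).
[cite: Burgisser2024Completeness, §4.2 (p0016 L50–L51)] -/
def blockGate (m r : ℕ) : Gate k (Var n) :=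
  if r < 4 * n then sideGate k n m false (m * (8 * n + 1)) r
  else if r < 8 * n then sideGate k n m true (m * (8 * n + 1) + 4 * n) (r - 4 * n)
  else .prod [.gate (m * (8 * n + 1) + 4 * n - 1), .gate (m * (8 * n + 1) + 8 * n - 1)]

/-- The prescribed value of `sideGate`. [cite: Burgisser2024Completeness, §4.2 (p0016 L50–L51)] -/
def sideVal (m : ℕ) (s : Bool) (r : ℕ) : MvPolynomial (Var n) k :=
  if r % 2 = 0 then coef k n (m + 1) (r / 2) s * tval k n m (r / 2)
  else ((List.range (r / 2 + 1)).map fun q => coef k n (m + 1) q s * tval k n m q).sum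

/-- The prescribed value of `blockGate`. [cite: Burgisser2024Completeness, §4.2 (p0016 L50–L51)] -/
def blockVal (m r : ℕ) : MvPolynomial (Var n) k :=
  if r < 4 * n then sideVal k n m false r
  else if r < 8 * n then sideVal k n m true (r - 4 * n)
  else value k n (n + m + 1)

/-- Even side gates are the products. [folklore] -/
private theorem sideGate_two_mul (m : ℕ) (s : Bool) (B q : ℕ) :
    sideGate k n m s B (2 * q) = .prod [.var (coefIdx n (m + 1) q s), opd k n m q] := by
  have h1 : 2 * q % 2 = 0 := Nat.mul_mod_right 2 q
  have h2 : 2 * q / 2 = q := Nat.mul_div_cancel_left q Nat.two_pos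
  simp only [sideGate, h1, h2, if_true]

/-- Side gate `1` copies the first product. [folklore] -/
private theorem sideGate_one (m : ℕ) (s : Bool) (B : ℕ) :
    sideGate k n m s B 1 = .sum [(1, .gate B)] := by
  simp [sideGate]

/-- Odd side gates `≥ 3` are the running sums. [folklore] -/
private theorem sideGate_two_mul_add_one (m : ℕ) (s : Bool) (B : ℕ) {q : ℕ} (hq : 0 < q) :
    sideGate k n m s B (2 * q + 1) = .sum [(1, .gate (B + 2 * q)), (1, .gate (B + (2 * q - 1)))] := by
  have h1 : ¬ (2 * q + 1) % 2 = 0 := by omega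
  have h2 : ¬ (2 * q + 1 = 1) := by omega
  have h3 : B + (2 * q + 1) - 1 = B + 2 * q := by omega
  have h4 : B + (2 * q + 1) - 2 = B + (2 * q - 1) := by omega
  simp only [sideGate, h1, h2, if_false, h3, h4]

/-- Prescribed value of an even side gate. [folklore] -/
private theorem sideVal_two_mul (m : ℕ) (s : Bool) (q : ℕ) :
    sideVal k n m s (2 * q) = coef k n (m + 1) q s * tval k n m q := by
  have h1 : 2 * q % 2 = 0 := Nat.mul_mod_right 2 q
  have h2 : 2 * q / 2 = q := Nat.mul_div_cancel_left q Nat.two_pos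
  simp only [sideVal, h1, h2, if_true]

/-- Prescribed value of side gate `0`. [folklore] -/
private theorem sideVal_zero (m : ℕ) (s : Bool) :
    sideVal k n m s 0 = coef k n (m + 1) 0 s * tval k n m 0 := by
  simpa using sideVal_two_mul k n m s 0

/-- Prescribed value of an odd side gate. [folklore] -/
private theorem sideVal_two_mul_add_one (m : ℕ) (s : Bool) (q : ℕ) :
    sideVal k n m s (2 * q + 1) =
      ((List.range (q + 1)).map fun q' => coef k n (m + 1) q' s * tval k n m q').sum := by
  have h1 : ¬ (2 * q + 1) % 2 = 0 := by omega
  have h2 : (2 * q + 1) / 2 = q := by omega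
  simp only [sideVal, h1, if_false, h2]

/-- The gates of the blocks of levels `1, …, M`. [cite: Burgisser2024Completeness, §4.2 (p0016 L50–L51)] -/
def blocks : ℕ → List (Gate k (Var n))
  | 0 => []
  | M + 1 => blocks M ++ (List.range (8 * n + 1)).map (blockGate k n M)

/-- `M` blocks have `M (8n+1)` gates. [cite: Burgisser2024Completeness, §4.2 (p0016 L50–L51)] -/
theorem length_blocks (M : ℕ) : (blocks k n M).length = M * (8 * n + 1) := by
  induction M with
  | zero => simp [blocks]
  | succ M ih => rw [blocks, List.length_append, ih, List.length_map, List.length_range]; ring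

/-- A complete running sum over the `2n` slots equals the linear form of (4.3) (slots beyond the
available values contribute `0`). [cite: Burgisser2024Completeness, §4.2 (4.3) (p0016 L48–L51)] -/
theorem sum_tval_eq {M : ℕ} (hM : M < n) (s : Bool) :
    ((List.range (2 * n)).map fun q => coef k n (M + 1) q s * tval k n M q).sum =
      ((List.range (n + M + 1)).map fun q => coef k n (M + 1) q s * value k n q).sum := by
  rw [show 2 * n = (n + M + 1) + (2 * n - (n + M + 1)) by omega, List.range_add, List.map_append,
    List.sum_append]
  have h1 : ((List.range (n + M + 1)).map fun q => coef k n (M + 1) q s * tval k n M q) =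
      (List.range (n + M + 1)).map fun q => coef k n (M + 1) q s * value k n q := by
    refine List.map_congr_left fun q hq => ?_
    rw [tval, if_pos (by have := List.mem_range.1 hq; omega)]
  have h2 : (((List.range (2 * n - (n + M + 1))).map fun q => n + M + 1 + q).map
      fun q => coef k n (M + 1) q s * tval k n M q).sum = 0 := by
    refine List.sum_eq_zero fun x hx => ?_
    obtain ⟨q, hq, rfl⟩ := List.mem_map.1 hx
    obtain ⟨j, -, rfl⟩ := List.mem_map.1 hq
    rw [tval, if_neg (by omega), mul_zero]
  rw [h1, h2, add_zero]

/-- **The values of the blocks**: the final gate of the block of level `m + 1` (absolute index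
`m (8n+1) + 8n`) has the value `G_{m+1}` (value index `n + m + 1`), for all `m < M ≤ n`.
[cite: Burgisser2024Completeness, §4.2 (p0016 L50–L51)] -/
theorem gateValues_blocks_final {M : ℕ} (hM : M ≤ n) {m : ℕ} (hm : m < M) :
    (gateValues (blocks k n M)).getD (m * (8 * n + 1) + 8 * n) 0 = value k n (n + m + 1) := by
  induction M generalizing m with
  | zero => exact absurd hm (Nat.not_lt_zero m)
  | succ M ih =>
    have hMn : M < n := Nat.lt_of_succ_le hM
    have ih' : ∀ m', m' < M →
        (gateValues (blocks k n M)).getD (m' * (8 * n + 1) + 8 * n) 0 = value k n (n + m' + 1) :=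
      fun m' hm' => ih hMn.le hm'
    -- the values of block `M`
    have hlen : (gateValues (blocks k n M)).length = M * (8 * n + 1) := by
      rw [gateValues_length, length_blocks]
    -- the operands
    have hopd : ∀ (q : ℕ) (ws : List (MvPolynomial (Var n) k)),
        (opd k n M q).eval (gateValues (blocks k n M) ++ ws) = tval k n M q := by
      intro q ws
      by_cases hq0 : q = 0
      · subst hq0
        rw [opd, if_pos rfl, tval, if_pos (Nat.zero_le _), value_zero]
        simp [Operand.eval]
      by_cases hqn : q ≤ n
      · rw [opd, if_neg hq0, if_pos hqn, tval, if_pos (by omega), value_input k n hqn, input, if_neg hq0]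
        simp [Operand.eval]
      by_cases hqM : q ≤ n + M
      · rw [opd, if_neg hq0, if_neg hqn, if_pos hqM, tval, if_pos hqM]
        simp only [Operand.eval]
        have hlt : (q - n - 1) * (8 * n + 1) + 8 * n < (gateValues (blocks k n M)).length := by
          rw [hlen]
          have : q - n - 1 + 1 ≤ M := by omega
          nlinarith
        rw [List.getD_append _ _ _ _ hlt, ih' (q - n - 1) (by omega)]
        congr 1; omega
      · rw [opd, if_neg hq0, if_neg hqn, if_neg hqM, tval, if_neg hqM]
        simp [Operand.eval]
    -- one side
    have hside : ∀ (s : Bool) (D r : ℕ) (ws : List (MvPolynomial (Var n) k)),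
        r < 4 * n → ws.length = D + r →
        (∀ j < r, ws.getD (D + j) 0 = sideVal k n M s j) →
        (sideGate k n M s (M * (8 * n + 1) + D) r).eval (gateValues (blocks k n M) ++ ws) =
          sideVal k n M s r := by
      intro s D r ws hr hws hprev
      have hread : ∀ j, j < r → (Operand.gate (M * (8 * n + 1) + D + j) : Operand k (Var n)).eval
          (gateValues (blocks k n M) ++ ws) = sideVal k n M s j := by
        intro j hj
        simp only [Operand.eval]
        rw [List.getD_append_right _ _ _ _ (by rw [hlen]; omega), hlen,
          show M * (8 * n + 1) + D + j - M * (8 * n + 1) = D + j by omega]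
        exact hprev j hj
      rcases Nat.even_or_odd' r with ⟨q, rfl | rfl⟩
      · -- even: the product `coef · G_q`
        rw [sideGate_two_mul, sideVal_two_mul]
        simp only [Gate.eval, List.map_cons, List.map_nil, List.prod_cons, List.prod_nil, mul_one,
          hopd]
        simp [Operand.eval, coef]
      · -- odd: the running sum `L_q = t_q + L_{q-1}` (`L_0 = t_0`)
        rcases Nat.eq_zero_or_pos q with rfl | hqpos
        · have h0 := hread 0 (by omega)
          rw [Nat.add_zero, sideVal_zero] at h0
          rw [show 2 * 0 + 1 = 1 by rfl, sideGate_one, show (1 : ℕ) = 2 * 0 + 1 by rfl,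
            sideVal_two_mul_add_one]
          simp only [Gate.eval, List.map_cons, List.map_nil, List.sum_cons, List.sum_nil, add_zero,
            one_smul, h0]
          simp
        · rw [sideGate_two_mul_add_one k n M s _ hqpos, sideVal_two_mul_add_one]
          simp only [Gate.eval, List.map_cons, List.map_nil, List.sum_cons, List.sum_nil, add_zero,
            one_smul]
          have h1 := hread (2 * q) (by omega)
          have h2 := hread (2 * q - 1) (by omega)
          rw [sideVal_two_mul] at h1
          rw [show 2 * q - 1 = 2 * (q - 1) + 1 by omega, sideVal_two_mul_add_one,
            show q - 1 + 1 = q by omega] at h2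
          rw [h1, show M * (8 * n + 1) + D + (2 * q - 1) =
            M * (8 * n + 1) + D + (2 * (q - 1) + 1) by omega, h2, List.range_succ, List.map_append,
            List.map_singleton, List.sum_append, List.sum_singleton, add_comm]
    -- the whole block
    have hblock := gateValues_append_map_range' (blocks k n M) (8 * n + 1) (blockGate k n M)
      (blockVal k n M) (by
        intro r hr ws hws hprev
        by_cases hr4 : r < 4 * n
        · rw [blockGate, if_pos hr4, blockVal, if_pos hr4,
            show M * (8 * n + 1) = M * (8 * n + 1) + 0 by rfl]
          refine hside false 0 r ws hr4 (by simpa using hws) fun j hj => ?_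
          rw [Nat.zero_add, hprev j hj, blockVal, if_pos (by omega)]
        by_cases hr8 : r < 8 * n
        · rw [blockGate, if_neg hr4, if_pos hr8, blockVal, if_neg hr4, if_pos hr8]
          refine hside true (4 * n) (r - 4 * n) ws (by omega) (by omega) fun j hj => ?_
          rw [hprev (4 * n + j) (by omega), blockVal, if_neg (by omega), if_pos (by omega),
            Nat.add_sub_cancel_left]
        · obtain rfl : r = 8 * n := by omega
          have hn : 1 ≤ n := by omega
          rw [blockGate, if_neg hr4, if_neg hr8, blockVal, if_neg hr4, if_neg hr8]
          simp only [Gate.eval, List.map_cons, List.map_nil, List.prod_cons, List.prod_nil, mul_one,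
            Operand.eval]
          rw [List.getD_append_right _ _ _ _ (by rw [hlen]; omega),
            List.getD_append_right _ _ _ _ (by rw [hlen]; omega), hlen,
            show M * (8 * n + 1) + 4 * n - 1 - M * (8 * n + 1) = 4 * n - 1 by omega,
            show M * (8 * n + 1) + 8 * n - 1 - M * (8 * n + 1) = 8 * n - 1 by omega,
            hprev _ (by omega), hprev _ (by omega), blockVal, if_pos (by omega), blockVal,
            if_neg (by omega), if_pos (by omega), show 8 * n - 1 - 4 * n = 4 * n - 1 by omega,
            show 4 * n - 1 = 2 * (2 * n - 1) + 1 by omega, sideVal_two_mul_add_one,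
            sideVal_two_mul_add_one, show 2 * n - 1 + 1 = 2 * n by omega, sum_tval_eq k n hMn,
            sum_tval_eq k n hMn, value_level k n (show n < n + M + 1 by omega),
            show n + M + 1 - n = M + 1 by omega])
    -- read the final gate
    rcases Nat.lt_succ_iff_lt_or_eq.1 hm with hm' | rfl
    · rw [blocks, hblock, List.getD_append _ _ _ _ (by rw [hlen]; nlinarith), ih' m hm']
    · rw [blocks, hblock, List.getD_append_right _ _ _ _ (by rw [hlen]; omega), hlen,
        Nat.add_sub_cancel_left, List.getD_eq_getElem?_getD, List.getElem?_map,
        List.getElem?_range (by omega)]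
      simp only [Option.map_some, Option.getD_some]
      rw [blockVal, if_neg (by omega), if_neg (by omega)]

/-- **The circuit for `G_n`**: the `n` blocks, output read through `opd`.
[cite: Burgisser2024Completeness, §4.2 (p0016 L50–L51)] -/
def circuit : ArithCircuit k (Var n) :=
  { gates := blocks k n n, output := opd k n n (2 * n) }

/-- Its size is `n (8n + 1)` (the survey: `O(mn + m²)` for `G_m`). [cite: Burgisser2024Completeness, §4.2 (p0016 L50–L51)] -/
theorem circuit_size : (circuit k n).size = n * (8 * n + 1) := length_blocks k n n

/-- It has fan-in two. [cite: Burgisser2024Completeness, §4.2 (p0016 L50–L51)] -/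
theorem circuit_isFanInTwo : (circuit k n).IsFanInTwo := by
  intro g hg
  change g ∈ blocks k n n at hg
  suffices h : ∀ M, g ∈ blocks k n M → g.fanIn ≤ 2 from h n hg
  intro M
  induction M with
  | zero => simp [blocks]
  | succ M ih =>
    intro hg
    rw [blocks, List.mem_append] at hg
    rcases hg with hg | hg
    · exact ih hg
    · obtain ⟨r, -, rfl⟩ := List.mem_map.1 hg
      unfold blockGate sideGate
      split_ifs <;> simp [Gate.fanIn, Gate.args]

/-- It is constant-free (constants `0, 1`, sum coefficients `1`). [cite: Burgisser2024Completeness, §4.2 (p0016 L50–L51)] -/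
theorem circuit_hasSignConstants : (circuit k n).HasSignConstants := by
  have hopd : ∀ m q, (opd k n m q).HasSignConstants := by
    intro m q
    unfold opd
    split_ifs
    · exact Or.inr (Or.inl rfl)
    · trivial
    · trivial
    · exact Or.inl rfl
  refine ⟨fun g hg => ?_, hopd n (2 * n)⟩
  change g ∈ blocks k n n at hg
  suffices h : ∀ M, g ∈ blocks k n M → g.HasSignConstants from h n hg
  intro M
  induction M with
  | zero => simp [blocks]
  | succ M ih =>
    intro hg
    rw [blocks, List.mem_append] at hg
    rcases hg with hg | hg
    · exact ih hg
    · obtain ⟨r, -, rfl⟩ := List.mem_map.1 hg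
      unfold blockGate sideGate
      split_ifs
      all_goals first
        | (intro u hu; simp only [List.mem_cons, List.mem_nil_iff, or_false] at hu
           rcases hu with rfl | rfl <;> first | trivial | exact hopd _ _)
        | (intro a ha; simp only [List.mem_cons, List.mem_nil_iff, or_false] at ha
           rcases ha with rfl | rfl <;> exact ⟨Or.inr (Or.inl rfl), trivial⟩)

/-- **The circuit computes `G_n`.** [cite: Burgisser2024Completeness, §4.2 (p0016 L50–L51)] -/
theorem circuit_computes : (circuit k n).Computes (genericComputation k n) := by
  change (opd k n n (2 * n)).eval (gateValues (blocks k n n)) = value k n (2 * n)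
  rcases Nat.eq_zero_or_pos n with rfl | hn
  · simp [opd, Operand.eval, value_zero]
  · simp only [opd, if_neg (show 2 * n ≠ 0 by omega), if_neg (show ¬ 2 * n ≤ n by omega),
      if_pos (show 2 * n ≤ n + n by omega), Operand.eval]
    rw [show 2 * n - n - 1 = n - 1 by omega, gateValues_blocks_final k n le_rfl (by omega)]
    congr 1; omega

/-! ## PART 2. Hardness: every constant-free circuit is a specialisation of `G_N`

"By specializing the auxiliary variables, it is easy to see that `(G_n)` is a `VPnb⁰`-complete
sequence" (p0016 L52–L54). Given a fan-in-two constant-free circuit `P` of size `s` over the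
variables `σ` (`v = #σ`), put `N = v + 2s + 1`; the inputs `x_1, …, x_v` of `G_N` are sent to the
variables of `σ` (`x_q ↦ 0` for `q > v`), and gate `ℓ` of `P` is simulated by the two levels
`2ℓ + 1, 2ℓ + 2`: a sum gate `c₁ u₁ + c₂ u₂` by `G_{2ℓ+1} = (c₁ [u₁]) · (1 [G_{-N}])` and
`G_{2ℓ+2} = (1 [G_{2ℓ+1}] + c₂ [u₂]) · (1 [G_{-N}])`, a product gate `u₁ u₂` by
`G_{2ℓ+1} = (1 [u₁]) · (1 [u₂])` and the copy `G_{2ℓ+2} = (1 [G_{2ℓ+1}]) · (1 [G_{-N}])` (here `[u]`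
is the value index holding the operand `u`: `G_{-N} = 1` for a constant — with the constant as
the coefficient —, an input for a variable, the second level of an earlier gate for a gate
reference); the levels above `2s` copy the output. All coefficients are `0, ±1` or constants /
sum coefficients of `P`, hence sign constants. -/

section Hardness

variable {k : Type u} [CommRing k] {σ : Type v} [Fintype σ] (N : ℕ) (P : ArithCircuit k σ)

/-- The encoding of an operand as seen by gate `i`: (value index of `G_N`, coefficient) — a
variable `x` is the input `1 + e(x)`, a constant `c` is `c · G_{-N}`, an earlier gate `j < i` is
the second level `N + 2j + 2` of its simulation, a junk reference is `0 · G_{-N}`.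
[cite: Burgisser2024Completeness, §4.2 (p0016 L52–L54)] -/
def enc (i : ℕ) : Operand k σ → ℕ × k
  | .var x => (1 + Fintype.equivFin σ x, 1)
  | .const c => (0, c)
  | .gate j => if j < i then (N + 2 * j + 2, 1) else (0, 0)

/-- A one-term coefficient vector: `c` at index `i`, `0` elsewhere. [cite: Burgisser2024Completeness, §4.2 (p0016 L52–L54)] -/
def delta (i : ℕ) (c : k) (q : ℕ) : k := if q = i then c else 0

/-- The specialisation of the `a`-coefficients `a_{m,q}` (level `m`, value index `q`).
[cite: Burgisser2024Completeness, §4.2 (p0016 L52–L54)] -/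
def aCoef (m q : ℕ) : k :=
  if m = 0 then 0
  else if m ≤ 2 * P.size then
    if m % 2 = 1 then
      match P.gates[(m - 1) / 2]? with
      | some (.sum ((c, u) :: _)) =>
          delta (enc N ((m - 1) / 2) u).1 (c * (enc N ((m - 1) / 2) u).2) q
      | some (.sum []) => 0
      | some (.prod (u :: _)) => delta (enc N ((m - 1) / 2) u).1 (enc N ((m - 1) / 2) u).2 q
      | some (.prod []) => delta 0 1 q
      | none => 0
    else if q = N + m - 1 then 1
    else
      match P.gates[(m - 1) / 2]? with
      | some (.sum (_ :: (c, w) :: _)) =>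
          delta (enc N ((m - 1) / 2) w).1 (c * (enc N ((m - 1) / 2) w).2) q
      | _ => 0
  else delta (enc N P.size P.output).1 (enc N P.size P.output).2 q

/-- The specialisation of the `b`-coefficients `b_{m,q}`. [cite: Burgisser2024Completeness, §4.2 (p0016 L52–L54)] -/
def bCoef (m q : ℕ) : k :=
  if m = 0 then 0
  else if m ≤ 2 * P.size ∧ m % 2 = 1 then
    match P.gates[(m - 1) / 2]? with
    | some (.prod (_ :: w :: _)) => delta (enc N ((m - 1) / 2) w).1 (enc N ((m - 1) / 2) w).2 q
    | _ => delta 0 1 q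
  else delta 0 1 q

/-- The specialisation of the variables of `G_N`: inputs to the variables of `σ` (or `0`),
coefficient variables to the constants `aCoef`, `bCoef`. [cite: Burgisser2024Completeness, §4.2 (p0016 L52–L54)] -/
def spec : Var N → MvPolynomial σ k
  | .inl i =>
      if h : 1 ≤ (i : ℕ) ∧ (i : ℕ) ≤ Fintype.card σ then
        X ((Fintype.equivFin σ).symm ⟨(i : ℕ) - 1, by omega⟩)
      else 0
  | .inr (m, q, false) => C (aCoef N P m q)
  | .inr (m, q, true) => C (bCoef N P m q)

/-- The value of the first simulation level `2ℓ + 1` of gate `ℓ`. [cite: Burgisser2024Completeness, §4.2 (p0016 L52–L54)] -/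
def firstVal (ℓ : ℕ) : MvPolynomial σ k :=
  match P.gates[ℓ]? with
  | some (.sum ((c, u) :: _)) => C c * P.opVal ℓ u
  | some (.sum []) => 0
  | some (.prod []) => 1
  | some (.prod [u]) => P.opVal ℓ u
  | some (.prod (u :: w :: _)) => P.opVal ℓ u * P.opVal ℓ w
  | none => 0

/-- The expected value of value index `q` of `G_N` under the specialisation.
[cite: Burgisser2024Completeness, §4.2 (p0016 L52–L54)] -/
def expect (q : ℕ) : MvPolynomial σ k :=
  if q ≤ N then aeval (spec N P) (input k N q)
  else if q - N ≤ 2 * P.size then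
    (if (q - N) % 2 = 1 then firstVal P ((q - N - 1) / 2) else P.gateVal ((q - N - 1) / 2))
  else P.eval

variable {N P}

/-- `expect 0 = 1` (`G_{-N} = 1`). [cite: Burgisser2024Completeness, §4.2 (p0016 L44)] -/
theorem expect_zero : expect N P 0 = 1 := by
  simp [expect, input]

/-- The input `1 + e(x)` specialises to `X x` (needs `#σ ≤ N`). [cite: Burgisser2024Completeness, §4.2 (p0016 L52–L54)] -/
theorem expect_var (hN : Fintype.card σ ≤ N) (x : σ) :
    expect N P (1 + Fintype.equivFin σ x) = X x := by
  have hx : (Fintype.equivFin σ x : ℕ) < Fintype.card σ := (Fintype.equivFin σ x).isLt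
  have hle : 1 + (Fintype.equivFin σ x : ℕ) ≤ N := by omega
  rw [expect, if_pos hle, input, if_neg (by omega), aeval_X, spec]
  have hval : ((Fin.ofNat (N + 1) (1 + (Fintype.equivFin σ x : ℕ)) : Fin (N + 1)) : ℕ) =
      1 + (Fintype.equivFin σ x : ℕ) := by
    simp [Fin.ofNat, Nat.mod_eq_of_lt (Nat.lt_succ_of_le hle)]
  rw [dif_pos (by rw [hval]; omega)]
  congr 1
  rw [Equiv.symm_apply_eq]
  apply Fin.ext
  show ((Fin.ofNat (N + 1) (1 + (Fintype.equivFin σ x : ℕ)) : Fin (N + 1)) : ℕ) - 1 = _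
  rw [hval]
  omega

/-- A second simulation level holds the gate value: `expect (N + 2j + 2) = gateVal j` (`j < s`).
[cite: Burgisser2024Completeness, §4.2 (p0016 L52–L54)] -/
theorem expect_gate {j : ℕ} (hj : j < P.size) : expect N P (N + 2 * j + 2) = P.gateVal j := by
  rw [expect, if_neg (by omega), if_pos (by omega), if_neg (by omega)]
  congr 1; omega

/-- **Operands**: `opVal i u = C (enc i u).2 · expect (enc i u).1` for `i ≤ s`.
[cite: Burgisser2024Completeness, §4.2 (p0016 L52–L54)] -/
theorem opVal_eq_enc (hN : Fintype.card σ ≤ N) {i : ℕ} (hi : i ≤ P.size) (u : Operand k σ) :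
    P.opVal i u = C (enc N i u).2 * expect N P (enc N i u).1 := by
  cases u with
  | var x => rw [ArithCircuit.opVal_var, enc, expect_var hN, map_one, one_mul]
  | const c => rw [ArithCircuit.opVal_const, enc, expect_zero, mul_one]
  | gate j =>
    rw [ArithCircuit.opVal_gate, enc]
    by_cases hji : j < i
    · rw [if_pos hji, if_pos hji, expect_gate (by omega), map_one, one_mul]
    · rw [if_neg hji, if_neg hji, map_zero, zero_mul]

/-- The indices produced by `enc i` lie below `N + 2i + 1` (inputs, `0`, or earlier second
levels). [cite: Burgisser2024Completeness, §4.2 (p0016 L52–L54)] -/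
theorem enc_fst_lt (hN : Fintype.card σ ≤ N) (i : ℕ) (u : Operand k σ) :
    (enc N i u).1 < N + 2 * i + 1 := by
  cases u with
  | var x => have := (Fintype.equivFin σ x).isLt; simp only [enc]; omega
  | const c => simp only [enc]; omega
  | gate j =>
    simp only [enc]
    by_cases h : j < i
    · rw [if_pos h]; show N + 2 * j + 2 < _; omega
    · rw [if_neg h]; show 0 < _; omega

omit [Fintype σ] in
/-- A one-term coefficient vector picks one value: `Σ_{q<Q} C(delta i c q) E_q = C c · E_i`
(`i < Q`). [folklore] -/
private theorem sum_delta (E : ℕ → MvPolynomial σ k) (i : ℕ) (c : k) {Q : ℕ} (hi : i < Q) :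
    ((List.range Q).map fun q => C (delta i c q) * E q).sum = C c * E i := by
  induction Q with
  | zero => exact absurd hi (Nat.not_lt_zero i)
  | succ Q ih =>
    rw [List.range_succ, List.map_append, List.map_singleton, List.sum_append, List.sum_singleton]
    rcases Nat.lt_succ_iff_lt_or_eq.1 hi with h | rfl
    · rw [ih h, delta, if_neg (by omega), map_zero, zero_mul, add_zero]
    · have h0 : ((List.range i).map fun q => C (delta i c q) * E q).sum = 0 :=
        List.sum_eq_zero fun x hx => by
          obtain ⟨q, hq, rfl⟩ := List.mem_map.1 hx
          rw [delta, if_neg (by have := List.mem_range.1 hq; omega), map_zero, zero_mul]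
      rw [h0, zero_add, delta, if_pos rfl]

omit [Fintype σ] in
/-- The zero coefficient vector gives `0`. [folklore] -/
private theorem sum_zero_coef (E : ℕ → MvPolynomial σ k) (Q : ℕ) :
    ((List.range Q).map fun q => C ((fun _ => (0 : k)) q) * E q).sum = 0 :=
  List.sum_eq_zero fun x hx => by
    obtain ⟨q, -, rfl⟩ := List.mem_map.1 hx
    rw [map_zero, zero_mul]

omit [Fintype σ] in
/-- "`1 · [G_i] +` a one-term vector" picks two values (`i`, `i'` distinct, below `Q`). [folklore] -/
private theorem sum_ite_delta (E : ℕ → MvPolynomial σ k) (i i' : ℕ) (c : k) {Q : ℕ} (hi : i < Q)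
    (hi' : i' < Q) (hne : i' ≠ i) :
    ((List.range Q).map fun q => C (if q = i then 1 else delta i' c q) * E q).sum =
      E i + C c * E i' := by
  have h : ∀ q, C (if q = i then (1 : k) else delta i' c q) * E q =
      C (delta i 1 q) * E q + C (delta i' c q) * E q := by
    intro q
    by_cases hq : q = i
    · subst hq
      rw [if_pos rfl, show delta q (1 : k) q = 1 from if_pos rfl, show delta i' c q = 0 from
        if_neg (Ne.symm hne), map_zero, zero_mul, add_zero]
    · rw [if_neg hq, show delta i (1 : k) q = 0 from if_neg hq, map_zero, zero_mul, zero_add]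
  simp_rw [h]
  rw [List.sum_map_add, sum_delta E i 1 hi, sum_delta E i' c hi', map_one, one_mul]

omit [Fintype σ] in
/-- "`1 · [G_i]`" alone. [folklore] -/
private theorem sum_ite_zero (E : ℕ → MvPolynomial σ k) (i : ℕ) {Q : ℕ} (hi : i < Q) :
    ((List.range Q).map fun q => C (if q = i then 1 else (0 : k)) * E q).sum = E i := by
  have := sum_delta E i 1 hi
  rw [map_one, one_mul] at this
  simpa only [delta] using this

/-- `aeval` of a linear form of (4.3) under the specialisation, given the values below.
[cite: Burgisser2024Completeness, §4.2 (4.3) (p0016 L48–L54)] -/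
theorem aeval_spec_linForm {Q m : ℕ} (hm : m ≤ N) (hQ : Q ≤ 2 * N + 1)
    (hE : ∀ q', q' < Q → aeval (spec N P) (value k N q') = expect N P q') (sd : Bool) :
    aeval (spec N P) (((List.range Q).map fun q' => coef k N m q' sd * value k N q').sum) =
      ((List.range Q).map fun q' =>
        C ((if sd then bCoef N P m q' else aCoef N P m q')) * expect N P q').sum := by
  rw [map_list_sum, List.map_map]
  refine congrArg List.sum (List.map_congr_left fun q' hq' => ?_)
  have hq'Q := List.mem_range.1 hq'
  rw [Function.comp_apply, map_mul, hE q' hq'Q, coef, aeval_X, coefIdx]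
  have h1 : ((Fin.ofNat (N + 1) m : Fin (N + 1)) : ℕ) = m := by
    simp [Fin.ofNat, Nat.mod_eq_of_lt (Nat.lt_succ_of_le hm)]
  have h2 : ((Fin.ofNat (2 * N + 1) q' : Fin (2 * N + 1)) : ℕ) = q' := by
    simp [Fin.ofNat, Nat.mod_eq_of_lt (lt_of_lt_of_le hq'Q hQ)]
  cases sd
  · simp only [spec, Bool.false_eq_true, if_false]
    rw [show (Fin.ofNat (N + 1) m : Fin (N + 1)) = ⟨m, Nat.lt_succ_of_le hm⟩ from Fin.ext h1,
      show (Fin.ofNat (2 * N + 1) q' : Fin (2 * N + 1)) = ⟨q', lt_of_lt_of_le hq'Q hQ⟩ from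
        Fin.ext h2]
  · simp only [spec, if_true]
    rw [show (Fin.ofNat (N + 1) m : Fin (N + 1)) = ⟨m, Nat.lt_succ_of_le hm⟩ from Fin.ext h1,
      show (Fin.ofNat (2 * N + 1) q' : Fin (2 * N + 1)) = ⟨q', lt_of_lt_of_le hq'Q hQ⟩ from
        Fin.ext h2]

/-- **The simulation**: under the specialisation every value of `G_N` is the expected one
(`N = #σ + 2s + 1`, `P` fan-in two). [cite: Burgisser2024Completeness, §4.2 (p0016 L52–L54)] -/
theorem aeval_spec_value (h2 : P.IsFanInTwo) (hN : N = Fintype.card σ + 2 * P.size + 1) :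
    ∀ q, q ≤ 2 * N → aeval (spec N P) (value k N q) = expect N P q := by
  have hNv : Fintype.card σ ≤ N := by omega
  intro q
  induction q using Nat.strong_induction_on with
  | _ q ih =>
    intro hq
    by_cases hqN : q ≤ N
    · rw [value_input k N hqN, expect, if_pos hqN]
    -- a level `m = q - N`, `1 ≤ m ≤ N`
    have hE : ∀ q', q' < q → aeval (spec N P) (value k N q') = expect N P q' :=
      fun q' hq' => ih q' hq' (by omega)
    rw [value_level k N (not_le.1 hqN), map_mul, aeval_spec_linForm (by omega) (by omega) hE,
      aeval_spec_linForm (by omega) (by omega) hE]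
    simp only [Bool.false_eq_true, if_false, if_true]
    -- name the level
    obtain ⟨m, rfl⟩ : ∃ m, q = N + m := ⟨q - N, by omega⟩
    have hm1 : 1 ≤ m := by omega
    have hmN : m ≤ N := by omega
    simp only [show N + m - N = m by omega]
    rw [expect, if_neg hqN]
    simp only [show N + m - N = m by omega]
    by_cases hms : m ≤ 2 * P.size
    · -- a simulation level of gate `ℓ = (m-1)/2`
      rw [if_pos hms]
      -- common facts about gate `ℓ`
      have hgate : ∀ ℓ, ℓ < P.size → ∃ g, P.gates[ℓ]? = some g ∧ g.fanIn ≤ 2 := fun ℓ hℓ =>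
        ⟨P.gates[ℓ]'(by rw [← ArithCircuit.size]; exact hℓ), List.getElem?_eq_getElem _,
          h2 _ (List.getElem_mem _)⟩
      have hop : ∀ ℓ, ℓ < P.size → ∀ u : Operand k σ,
          P.opVal ℓ u = C (enc N ℓ u).2 * expect N P (enc N ℓ u).1 :=
        fun ℓ hℓ u => opVal_eq_enc hNv hℓ.le u
      rcases Nat.even_or_odd' m with ⟨j, rfl | rfl⟩
      · -- second level `m = 2j = 2ℓ + 2`, `ℓ = j - 1`
        obtain ⟨ℓ, rfl⟩ : ∃ ℓ, j = ℓ + 1 := ⟨j - 1, by omega⟩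
        have hℓs : ℓ < P.size := by omega
        obtain ⟨g, hg, hfan⟩ := hgate ℓ hℓs
        have henc : ∀ u : Operand k σ, (enc N ℓ u).1 < N + 2 * (ℓ + 1) := fun u =>
          lt_of_lt_of_le (enc_fst_lt hNv ℓ u) (by omega)
        have hmod : ¬ (2 * (ℓ + 1)) % 2 = 1 := by omega
        have hdiv : (2 * (ℓ + 1) - 1) / 2 = ℓ := by omega
        rw [if_neg hmod, hdiv]
        -- the coefficients
        have ha : ∀ q', aCoef N P (2 * (ℓ + 1)) q' = if q' = N + 2 * (ℓ + 1) - 1 then 1 else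
            (match P.gates[ℓ]? with
              | some (.sum (_ :: (c, w) :: _)) => delta (enc N ℓ w).1 (c * (enc N ℓ w).2) q'
              | _ => 0) := by
          intro q'
          rw [aCoef, if_neg (by omega), if_pos hms, if_neg hmod, hdiv]
        have hb : ∀ q', bCoef N P (2 * (ℓ + 1)) q' = delta 0 1 q' := by
          intro q'
          rw [bCoef, if_neg (by omega), if_neg (by omega)]
        simp_rw [ha, hb, hg]
        rw [sum_delta _ 0 1 (by omega), expect_zero, map_one, mul_one, mul_one]
        -- first level value at index `N + 2ℓ + 1`
        have hfirst : expect N P (N + 2 * (ℓ + 1) - 1) = firstVal P ℓ := by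
          rw [expect, if_neg (by omega), if_pos (by omega), if_pos (by omega)]
          congr 1; omega
        cases g with
        | sum args =>
          rw [P.gateVal_of_sum hg]
          rcases args with _ | ⟨⟨c₁, u₁⟩, _ | ⟨⟨c₂, u₂⟩, _ | ⟨e, rest⟩⟩⟩
          · simp only
            rw [sum_ite_zero _ _ (by omega), hfirst, firstVal, hg]
            simp
          · simp only
            rw [sum_ite_zero _ _ (by omega), hfirst, firstVal, hg]
            simp [hop ℓ hℓs, smul_eq_C_mul]
          · simp only
            rw [sum_ite_delta _ _ _ _ (by omega) (henc u₂)
                (by have := enc_fst_lt hNv ℓ u₂; omega), hfirst, firstVal, hg]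
            simp [hop ℓ hℓs, smul_eq_C_mul, mul_assoc]
          · simp [Gate.fanIn, Gate.args] at hfan
        | prod args =>
          rw [P.gateVal_of_prod hg]
          simp only
          rw [sum_ite_zero _ _ (by omega), hfirst, firstVal, hg]
          rcases args with _ | ⟨u₁, _ | ⟨u₂, _ | ⟨e, rest⟩⟩⟩
          · simp
          · simp
          · simp
          · simp [Gate.fanIn, Gate.args] at hfan
      · -- first level `m = 2j + 1 = 2ℓ + 1`
        have hℓs : j < P.size := by omega
        obtain ⟨g, hg, hfan⟩ := hgate j hℓs
        have henc : ∀ u : Operand k σ, (enc N j u).1 < N + (2 * j + 1) := fun u =>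
          lt_of_lt_of_le (enc_fst_lt hNv j u) (by omega)
        have hmod : (2 * j + 1) % 2 = 1 := by omega
        have hdiv : (2 * j + 1 - 1) / 2 = j := by omega
        rw [if_pos hmod, hdiv, firstVal, hg]
        have ha : ∀ q', aCoef N P (2 * j + 1) q' =
            (match (some g : Option (Gate k σ)) with
              | some (.sum ((c, u) :: _)) => delta (enc N j u).1 (c * (enc N j u).2) q'
              | some (.sum []) => 0
              | some (.prod (u :: _)) => delta (enc N j u).1 (enc N j u).2 q'
              | some (.prod []) => delta 0 1 q'
              | none => 0) := by
          intro q'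
          rw [aCoef, if_neg (by omega), if_pos hms, if_pos hmod, hdiv, hg]
        have hb : ∀ q', bCoef N P (2 * j + 1) q' =
            (match (some g : Option (Gate k σ)) with
              | some (.prod (_ :: w :: _)) => delta (enc N j w).1 (enc N j w).2 q'
              | _ => delta 0 1 q') := by
          intro q'
          rw [bCoef, if_neg (by omega), if_pos ⟨hms, hmod⟩, hdiv, hg]
        simp_rw [ha, hb]
        cases g with
        | sum args =>
          rcases args with _ | ⟨⟨c₁, u₁⟩, rest⟩
          · simp only
            rw [sum_zero_coef, zero_mul]
          · simp only
            rw [sum_delta _ _ _ (henc u₁), sum_delta _ 0 1 (by omega), hop j hℓs u₁]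
            simp [expect_zero, mul_assoc]
        | prod args =>
          rcases args with _ | ⟨u₁, _ | ⟨u₂, rest⟩⟩
          · simp only
            rw [sum_delta _ 0 1 (by omega)]
            simp [expect_zero]
          · simp only
            rw [sum_delta _ _ _ (henc u₁), sum_delta _ 0 1 (by omega), hop j hℓs u₁]
            simp [expect_zero]
          · simp only
            rcases rest with _ | ⟨e, rest⟩
            · rw [sum_delta _ _ _ (henc u₁), sum_delta _ _ _ (henc u₂), hop j hℓs u₁, hop j hℓs u₂]
            · simp [Gate.fanIn, Gate.args] at hfan
    · -- a copy level `m > 2s`: the output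
      rw [if_neg hms]
      have ha : ∀ q', aCoef N P m q' = delta (enc N P.size P.output).1 (enc N P.size P.output).2 q' := by
        intro q'; rw [aCoef, if_neg (by omega), if_neg hms]
      have hb : ∀ q', bCoef N P m q' = delta 0 1 q' := by
        intro q'; rw [bCoef, if_neg (by omega), if_neg (by omega)]
      simp_rw [ha, hb]
      rw [sum_delta _ _ _ (lt_of_lt_of_le (enc_fst_lt hNv P.size P.output) (by omega)),
        sum_delta _ 0 1 (by omega), expect_zero, map_one, mul_one, mul_one,
        ← opVal_eq_enc hNv le_rfl, ArithCircuit.eval_eq_opVal_output]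

/-- **The specialisation uses variables and sign constants only** (for a constant-free `P`).
[cite: Burgisser2024Completeness, §4.2 (p0016 L52–L54)] -/
theorem spec_isVarOrSignConst (hsc : P.HasSignConstants) (i : Var N) :
    (∃ x, spec N P i = X x) ∨ ∃ c : k, IsSignConstant c ∧ spec N P i = C c := by
  -- sign constants are closed under products
  have hmul : ∀ a b : k, IsSignConstant a → IsSignConstant b → IsSignConstant (a * b) := by
    intro a b ha hb
    rcases ha with rfl | rfl | ha
    · exact Or.inl (zero_mul b)
    · simpa using hb
    · obtain rfl : a = -1 := eq_neg_of_add_eq_zero_left ha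
      rcases hb with rfl | rfl | hb
      · exact Or.inl (by simp)
      · exact Or.inr (Or.inr (by simp))
      · obtain rfl : b = -1 := eq_neg_of_add_eq_zero_left hb
        exact Or.inr (Or.inl (by simp))
  have henc : ∀ (i : ℕ) (u : Operand k σ), u.HasSignConstants → IsSignConstant (enc N i u).2 := by
    intro i u hu
    cases u with
    | var x => exact Or.inr (Or.inl rfl)
    | const c => exact hu
    | gate j => simp only [enc]; split_ifs; exacts [Or.inr (Or.inl rfl), Or.inl rfl]
  have hdelta : ∀ (i : ℕ) (c : k) (q : ℕ), IsSignConstant c → IsSignConstant (delta i c q) := by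
    intro i c q hc; unfold delta; split_ifs; exacts [hc, Or.inl rfl]
  have hgate : ∀ (ℓ : ℕ) (g : Gate k σ), P.gates[ℓ]? = some g → g.HasSignConstants :=
    fun ℓ g hg => hsc.1 g (List.mem_of_getElem? hg)
  rcases i with i | ⟨m, q, sd⟩
  · simp only [spec]
    split_ifs
    · exact Or.inl ⟨_, rfl⟩
    · exact Or.inr ⟨0, Or.inl rfl, by simp⟩
  · cases sd
    · refine Or.inr ⟨aCoef N P m q, ?_, rfl⟩
      unfold aCoef
      split_ifs with h0 h1 h2 h3
      · exact Or.inl rfl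
      · rcases hg : P.gates[((m : ℕ) - 1) / 2]? with _ | ⟨_ | ⟨⟨c, u⟩, rest⟩⟩ | ⟨_ | ⟨u, rest⟩⟩
        · exact Or.inl rfl
        · exact Or.inl rfl
        · exact hdelta _ _ _ (hmul _ _ ((hgate _ _ hg) (c, u) (by simp)).1
            (henc _ _ ((hgate _ _ hg) (c, u) (by simp)).2))
        · exact hdelta _ _ _ (Or.inr (Or.inl rfl))
        · exact hdelta _ _ _ (henc _ _ ((hgate _ _ hg) u (by simp)))
      · exact Or.inr (Or.inl rfl)
      · rcases hg : P.gates[((m : ℕ) - 1) / 2]? with _ | ⟨_ | ⟨a, _ | ⟨⟨c, w⟩, rest⟩⟩⟩ | args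
        · exact Or.inl rfl
        · exact Or.inl rfl
        · exact Or.inl rfl
        · exact hdelta _ _ _ (hmul _ _ ((hgate _ _ hg) (c, w) (by simp)).1
            (henc _ _ ((hgate _ _ hg) (c, w) (by simp)).2))
        · exact Or.inl rfl
      · exact hdelta _ _ _ (henc _ _ hsc.2)
    · refine Or.inr ⟨bCoef N P m q, ?_, rfl⟩
      unfold bCoef
      split_ifs with h0 h1
      · exact Or.inl rfl
      · rcases hg : P.gates[((m : ℕ) - 1) / 2]? with _ | ⟨args⟩ | ⟨_ | ⟨u, _ | ⟨w, rest⟩⟩⟩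
        · exact hdelta _ _ _ (Or.inr (Or.inl rfl))
        · exact hdelta _ _ _ (Or.inr (Or.inl rfl))
        · exact hdelta _ _ _ (Or.inr (Or.inl rfl))
        · exact hdelta _ _ _ (Or.inr (Or.inl rfl))
        · exact hdelta _ _ _ (henc _ _ ((hgate _ _ hg) w (by simp)))
      · exact hdelta _ _ _ (Or.inr (Or.inl rfl))

/-- For an arbitrary circuit over `k` the specialisation uses variables and constants of `k`
(the constants / sum coefficients of `P` and `0, ±1`). [cite: Burgisser2024Completeness, §4.2 (p0016 L8–L11, L52–L54)] -/
theorem spec_isVarOrConst (i : Var N) : (∃ x, spec N P i = X x) ∨ ∃ c : k, spec N P i = C c := by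
  rcases i with i | ⟨m, q, sd⟩
  · simp only [spec]
    split_ifs
    · exact Or.inl ⟨_, rfl⟩
    · exact Or.inr ⟨0, by simp⟩
  · cases sd
    · exact Or.inr ⟨_, rfl⟩
    · exact Or.inr ⟨_, rfl⟩

/-- **Every fan-in-two circuit (over any commutative ring `k`) is a specialisation of `G_N`**,
`N = #σ + 2s + 1` ("by specializing the auxiliary variables"; the substituted constants are the
constants and sum coefficients of the circuit and `0, ±1` — sign constants for a constant-free
circuit, `spec_isVarOrSignConst`).
[cite: Burgisser2024Completeness, §4.2 (p0016 L52–L54)] -/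
theorem eval_eq_aeval_spec_genericComputation (h2 : P.IsFanInTwo) :
    P.eval = aeval (spec (Fintype.card σ + 2 * P.size + 1) P)
      (genericComputation k (Fintype.card σ + 2 * P.size + 1)) := by
  rw [genericComputation, aeval_spec_value h2 rfl _ le_rfl, expect, if_neg (by omega),
    if_neg (by omega)]

end Hardness

end MalodGeneric

/-- **`(G_n) ∈ VPnb⁰`** (Bürgisser 2024, §4.2: "`G_m` can be computed by a constant-free circuit
of size `O(mn + m²)`"): Malod's generic computation is a `VPnb⁰` family — one fan-in-two
constant-free circuit of size `n (8n+1)` per `n`, in `(n+1) + 2 (n+1)(2n+1)` variables.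
[cite: Burgisser2024Completeness, §4.2 (p0016 L50–L54)] -/
theorem isVPnb0Family_genericComputation :
    IsVPnb0Family fun n => MalodGeneric.genericComputation ℤ n := by
  have hsq : IsPBounded fun n => (n + 1) ^ 2 :=
    IsPBounded.pow_holds (IsPBounded.add_holds IsPBounded.id (IsPBounded.const 1)) 2
  refine ⟨(IsPBounded.mul_holds (IsPBounded.const 15) hsq).mono fun n => ?_,
    fun n => MalodGeneric.circuit ℤ n, fun n =>
    ⟨MalodGeneric.circuit_isFanInTwo ℤ n, MalodGeneric.circuit_hasSignConstants ℤ n,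
      MalodGeneric.circuit_computes ℤ n⟩,
    (IsPBounded.mul_holds (IsPBounded.const 9) hsq).mono fun n => ?_⟩
  · simp only [MalodGeneric.Var, Fintype.card_sum, Fintype.card_prod, Fintype.card_fin,
      Fintype.card_bool]
    nlinarith
  · show (MalodGeneric.circuit ℤ n).size ≤ 9 * (n + 1) ^ 2
    rw [MalodGeneric.circuit_size]
    nlinarith

/-- **Bürgisser 2024, §4.2: "(G_n) is a `VPnb⁰`-complete sequence."** Membership
(`isVPnb0Family_genericComputation`) and hardness: every `VPnb⁰` family `f` (in any variable
types) is a p-projection of `(G_n)` whose substituted constants are moreover sign constants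
`0, ±1` — `f_n = G_{t(n)}(spec)` with `t(n) = #σ_n + 2 |C_n| + 1` for the circuits `C_n`
witnessing `f ∈ VPnb⁰`. In particular `IsPProjection f (G_n)` in the tree's sense.
[cite: Burgisser2024Completeness, §4.2 (p0016 L50–L54)] -/
theorem Bur24_sec4_2_genericComputation_VPnb0Complete :
    IsVPnb0Family (fun n => MalodGeneric.genericComputation ℤ n) ∧
      ∀ {σ : ℕ → Type v} [∀ n, Fintype (σ n)] (f : ∀ n, MvPolynomial (σ n) ℤ),
        IsVPnb0Family f →
          ∃ t : ℕ → ℕ, IsPBounded t ∧ ∀ n,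
            ∃ φ : MalodGeneric.Var (t n) → MvPolynomial (σ n) ℤ,
              (∀ i, (∃ x, φ i = X x) ∨ ∃ c : ℤ, ArithCircuit.IsSignConstant c ∧ φ i = C c) ∧
                f n = aeval φ (MalodGeneric.genericComputation ℤ (t n)) := by
  refine ⟨isVPnb0Family_genericComputation, fun {σ} _ f hf => ?_⟩
  obtain ⟨hcard, C, hC, hsize⟩ := hf
  refine ⟨fun n => Fintype.card (σ n) + 2 * (C n).size + 1,
    IsPBounded.add_holds (IsPBounded.add_holds hcard
      (IsPBounded.mul_holds (IsPBounded.const 2) hsize)) (IsPBounded.const 1), fun n => ?_⟩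
  refine ⟨MalodGeneric.spec _ (C n), MalodGeneric.spec_isVarOrSignConst (hC n).2.1, ?_⟩
  rw [← (hC n).2.2]
  exact MalodGeneric.eval_eq_aeval_spec_genericComputation (hC n).1

/-- In particular every `VPnb⁰` family is a p-projection of `(G_n)` (`IsPProjection`).
[cite: Burgisser2024Completeness, §4.2 (p0016 L52–L54)] -/
theorem IsVPnb0Family.isPProjection_genericComputation {σ : ℕ → Type v} [∀ n, Fintype (σ n)]
    {f : ∀ n, MvPolynomial (σ n) ℤ} (hf : IsVPnb0Family f) :
    IsPProjection f (fun n => MalodGeneric.genericComputation ℤ n) := by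
  obtain ⟨t, ht, h⟩ := Bur24_sec4_2_genericComputation_VPnb0Complete.2 f hf
  refine ⟨t, ht, fun n => ?_⟩
  obtain ⟨φ, hφ, hf⟩ := h n
  refine ⟨φ, fun i => ?_, hf⟩
  rcases hφ i with h | ⟨c, -, hc⟩
  · exact Or.inl h
  · exact Or.inr ⟨c, hc⟩

end Literature.Computability.AlgebraicComplexity

end
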